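import Mathlib
import Summits.Ventures.HSemireg.LineLawClassLawNecessity
import Summits.Ventures.HSemireg.LineLawConverse

/-!
# LINE LAW — THEOREM E «⇐» in kernel form: an aligned compatible family plus an auxiliary ideal gives the data (ENGINE-W code B, #B20)

THEOREM E of the LINE LAW (card LINE-LAW-B.md §22, consolidated text LINE-LAW-THEOREMS-B.md §6″), sufficiency half: if one
residue `A` makes the weight ideals `𝔞_c(A) = (c, −A + √m)`, `c ∈ S`, a compatible family lying in ONE ideal class `κ`, then `S`
is factorwise reachable — at `T = L · r` (`L` a common multiple of the weights, `𝔯 = 𝔞_r(A)` an auxiliary primitive ideal in the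
class `κ − [𝔞_L(A)]`), because every `𝔞_{T∕c}(A) = 𝔯 · 𝔞_{L∕c}(A)` then has the trivial class, is principal `= (z_c)`, and
`z_c ∣ A − √m`, `N z_c = T∕c` (§11 PROPOSITION).  In the tree so far: pairs and triples of coprime PRIME weights
(`LineLawPairLaw.pairLaw_reached_of_aligned` ∕ `tripleLaw_reached_of_aligned`, coprime product formula).  This file proves the
GENERAL statement — arbitrary weights sharing primes, arbitrary finite families — with the class hypotheses written as Cox-(7.8)
relations at the common root `A` (the CRT step that produces `A` from the separate roots, and the EXISTENCE of the auxiliary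
ideal in the prescribed class — Cox Cor. 7.17 — stay by value, exactly as in `LineLawPairLaw`):
* `weightDatum_of_aligned` — ONE weight `c` with `c · d = L`: from the alignment `(x)·𝔞_c(A) = (y)·𝔞_{c₀}(A)`, the auxiliary
  relation `(x₀)·𝔞_r(A)·𝔞_L(A) = (y₀)·𝔞_{c₀}(A)`, the bookkeeping hypotheses `gcd(d, c, 2A) = gcd(r, d, 2A) = 1`,
  `r L ∣ A² − m`, and a PROPER base ideal `𝔞_{c₀}(A)` (primitive form — Cox (7.6) `𝔞 𝔞̄ = (c₀)` cancels it): a primitive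
  `z ∈ ℤ√m` with `N z = r · d = T∕c` dividing `A − √m`;
* `classLaw_sufficiency` — the Finset family form: every weight of the family gets its datum at the SAME `(T, A) = (r L, A)`,
  i.e. THEOREM CF⁶'s criterion for the whole line.
* `firstWinding_relation` — the CLASS CONDITION ON THE COFACTOR (LINE-LAW-THEOREMS-B.md §6⁗, the «which T» corollary,
  «⇒» half): a datum of the weight `c` at `T = s · L` with `gcd(s, L, 2A) = 1` satisfies `(z_c)·𝔞_c(A) = 𝔞_s(A)·𝔞_L(A)` —
  i.e. `[𝔞_s(A)] = κ − [𝔞_L(A)]`, the sign-repaired statement of REF-W ROW 355; the «⇐» half is `weightDatum_of_aligned` with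
  `r = s`.
Uses #B14 `LineLawIdealProduct.primIdeal_mul_of_gcd` (one-sided bookkeeping `𝔞_{n₁}𝔞_{n₂} = 𝔞_{n₁n₂}`), #B17
`LineLawClassLawNecessity.principal_mul_weightIdeal` (`(z_c)·𝔞_c(A) = 𝔞_T(A)`) and `LineLawConverse.principal_norm_of_rel`
(a Cox-(7.8) relation `(x)·𝔞_n(A) = (t)` yields the element).  With #B17 («⇒») THEOREM E is kernel in both directions modulo
the two by-value inputs named above.
Honest framing: ideal arithmetic in `ℤ√m` (`m < 0`) only; THEOREM CF⁶ by value; Mukai vectors and lattices elsewhere, not objects;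
nothing here says that HC, HC_CM or HC_AV holds.
-/

namespace Summit.Ventures.HSemireg.LineLawClassLawSufficiency

open Zsqrtd
open Literature.NumberTheory.QuadraticFields.Quadratic.BinQF (span_pair_mul_span_pair_neg)
open HSemireg.LineLawIdealProduct (primIdeal_mul_of_gcd)
open Summit.Ventures.HSemireg.LineLawConverse (principal_norm_of_rel)
open Summit.Ventures.HSemireg.LineLawClassLawNecessity (principal_mul_weightIdeal)

/-- **THEOREM E «⇐», one weight.**  `m < 0`; a weight `c` with `c · d = L` (`d = L∕c > 0`), an auxiliary norm `r > 0` with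
`r L ∣ A² − m`; bookkeeping hypotheses `gcd(d, c, 2A) = 1`, `gcd(r, d, 2A) = 1`; a base weight `c₀ ≠ 0` whose form
`(c₀, 2A, k₀)` (`A² − c₀ k₀ = m`) is primitive; ALIGNMENT `(x)·𝔞_c(A) = (y)·𝔞_{c₀}(A)` and AUXILIARY CLASS
`(x₀)·(𝔞_r(A)·𝔞_L(A)) = (y₀)·𝔞_{c₀}(A)` with `x₀, y ≠ 0`.  Then some primitive `z ∈ ℤ√m` with `N z = r d` divides `A − √m`
— the datum of the weight `c` at `T = r L`.  Proof: `𝔞_{rd} 𝔞_c = 𝔞_r 𝔞_d 𝔞_c = 𝔞_r 𝔞_L` (#B14 twice), so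
`(x₀ y)·𝔞_{rd}·𝔞_{c₀} = (y₀ x)·𝔞_{c₀}`; cancel `𝔞_{c₀}` by `𝔞_{c₀} 𝔞̄_{c₀} = (c₀)` (Cox (7.6)); the principal ideal
`𝔞_{rd}` yields `z` (§11 PROPOSITION via `principal_norm_of_rel`). -/
theorem weightDatum_of_aligned {m : ℤ} (hm : m < 0) {A r L c d c₀ k₀ : ℤ} (hr : 0 < r) (hd : 0 < d) (hc₀ : c₀ ≠ 0)
    (hcd : c * d = L) (hdiv : r * L ∣ A * A - m)
    (hg1 : Int.gcd (Int.gcd d c : ℤ) (2 * A) = 1) (hg2 : Int.gcd (Int.gcd r d : ℤ) (2 * A) = 1)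
    (hk₀ : A ^ 2 - c₀ * k₀ = m) (hp₀ : ∃ x y z : ℤ, x * c₀ + y * (2 * A) + z * k₀ = 1)
    {x₀ y₀ x y : ℤ√m} (hx₀ : x₀ ≠ 0) (hy : y ≠ 0)
    (halign : Ideal.span {x} * Ideal.span {(c : ℤ√m), ⟨-A, 1⟩} = Ideal.span {y} * Ideal.span {(c₀ : ℤ√m), ⟨-A, 1⟩})
    (haux : Ideal.span {x₀} * (Ideal.span {(r : ℤ√m), ⟨-A, 1⟩} * Ideal.span {(L : ℤ√m), ⟨-A, 1⟩}) =
      Ideal.span {y₀} * Ideal.span {(c₀ : ℤ√m), ⟨-A, 1⟩}) :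
    ∃ z : ℤ√m, z.norm = r * d ∧ z ∣ (⟨A, -1⟩ : ℤ√m) ∧ IsCoprime z.re z.im := by
  haveI : IsDomain (ℤ√m) := Zsqrtd.isDomain_of_neg hm
  -- bookkeeping: 𝔞_r 𝔞_d = 𝔞_{rd}, 𝔞_d 𝔞_c = 𝔞_L
  have hrd : r * d ∣ A * A - m := dvd_trans (mul_dvd_mul_left r ⟨c, by rw [← hcd, mul_comm]⟩) hdiv
  have hdc : d * c ∣ A * A - m := dvd_trans ⟨r, by rw [← hcd]; ring⟩ hdiv
  have P1 : Ideal.span {(r : ℤ√m), ⟨-A, 1⟩} * Ideal.span {(d : ℤ√m), ⟨-A, 1⟩} =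
      Ideal.span {((r * d : ℤ) : ℤ√m), ⟨-A, 1⟩} := primIdeal_mul_of_gcd hrd hg2
  have P2 : Ideal.span {(d : ℤ√m), ⟨-A, 1⟩} * Ideal.span {(c : ℤ√m), ⟨-A, 1⟩} =
      Ideal.span {(L : ℤ√m), ⟨-A, 1⟩} := by
    rw [primIdeal_mul_of_gcd hdc hg1, show (d * c : ℤ) = L by rw [mul_comm, hcd]]
  -- 𝔞_{rd} 𝔞_c = 𝔞_r 𝔞_L
  have P3 : Ideal.span {((r * d : ℤ) : ℤ√m), ⟨-A, 1⟩} * Ideal.span {(c : ℤ√m), ⟨-A, 1⟩} =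
      Ideal.span {(r : ℤ√m), ⟨-A, 1⟩} * Ideal.span {(L : ℤ√m), ⟨-A, 1⟩} := by
    rw [← P1, mul_assoc, P2]
  -- (x₀ y)·𝔞_{rd}·𝔞_{c₀} = (y₀ x)·𝔞_{c₀}
  have E : Ideal.span {x₀ * y} * (Ideal.span {((r * d : ℤ) : ℤ√m), ⟨-A, 1⟩} * Ideal.span {(c₀ : ℤ√m), ⟨-A, 1⟩}) =
      Ideal.span {y₀ * x} * Ideal.span {(c₀ : ℤ√m), ⟨-A, 1⟩} := by
    rw [← Ideal.span_singleton_mul_span_singleton, ← Ideal.span_singleton_mul_span_singleton]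
    calc Ideal.span {x₀} * Ideal.span {y} * (Ideal.span {((r * d : ℤ) : ℤ√m), ⟨-A, 1⟩} * Ideal.span {(c₀ : ℤ√m), ⟨-A, 1⟩})
        = Ideal.span {x₀} * Ideal.span {((r * d : ℤ) : ℤ√m), ⟨-A, 1⟩} *
            (Ideal.span {y} * Ideal.span {(c₀ : ℤ√m), ⟨-A, 1⟩}) := by ring
      _ = Ideal.span {x₀} * Ideal.span {((r * d : ℤ) : ℤ√m), ⟨-A, 1⟩} *
            (Ideal.span {x} * Ideal.span {(c : ℤ√m), ⟨-A, 1⟩}) := by rw [halign]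
      _ = Ideal.span {x} * (Ideal.span {x₀} *
            (Ideal.span {((r * d : ℤ) : ℤ√m), ⟨-A, 1⟩} * Ideal.span {(c : ℤ√m), ⟨-A, 1⟩})) := by ring
      _ = Ideal.span {x} * (Ideal.span {x₀} *
            (Ideal.span {(r : ℤ√m), ⟨-A, 1⟩} * Ideal.span {(L : ℤ√m), ⟨-A, 1⟩})) := by rw [P3]
      _ = Ideal.span {x} * (Ideal.span {y₀} * Ideal.span {(c₀ : ℤ√m), ⟨-A, 1⟩}) := by rw [haux]
      _ = Ideal.span {y₀} * Ideal.span {x} * Ideal.span {(c₀ : ℤ√m), ⟨-A, 1⟩} := by ring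
  -- cancel 𝔞_{c₀} with its conjugate: 𝔞_{c₀} 𝔞̄_{c₀} = (c₀)
  have C : Ideal.span {(c₀ : ℤ√m), ⟨-A, 1⟩} * Ideal.span {(c₀ : ℤ√m), ⟨-(-A), 1⟩} = Ideal.span {(c₀ : ℤ√m)} :=
    span_pair_mul_span_pair_neg hk₀ hp₀
  have E2 : Ideal.span {x₀ * y * (c₀ : ℤ√m)} * Ideal.span {((r * d : ℤ) : ℤ√m), ⟨-A, 1⟩} =
      Ideal.span {y₀ * x * (c₀ : ℤ√m)} := by
    calc Ideal.span {x₀ * y * (c₀ : ℤ√m)} * Ideal.span {((r * d : ℤ) : ℤ√m), ⟨-A, 1⟩}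
        = Ideal.span {x₀ * y} * Ideal.span {(c₀ : ℤ√m)} * Ideal.span {((r * d : ℤ) : ℤ√m), ⟨-A, 1⟩} := by
          rw [Ideal.span_singleton_mul_span_singleton]
      _ = Ideal.span {x₀ * y} * (Ideal.span {(c₀ : ℤ√m), ⟨-A, 1⟩} * Ideal.span {(c₀ : ℤ√m), ⟨-(-A), 1⟩}) *
            Ideal.span {((r * d : ℤ) : ℤ√m), ⟨-A, 1⟩} := by rw [C]
      _ = Ideal.span {x₀ * y} * (Ideal.span {((r * d : ℤ) : ℤ√m), ⟨-A, 1⟩} * Ideal.span {(c₀ : ℤ√m), ⟨-A, 1⟩}) *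
            Ideal.span {(c₀ : ℤ√m), ⟨-(-A), 1⟩} := by ring
      _ = Ideal.span {y₀ * x} * Ideal.span {(c₀ : ℤ√m), ⟨-A, 1⟩} * Ideal.span {(c₀ : ℤ√m), ⟨-(-A), 1⟩} := by rw [E]
      _ = Ideal.span {y₀ * x} * (Ideal.span {(c₀ : ℤ√m), ⟨-A, 1⟩} * Ideal.span {(c₀ : ℤ√m), ⟨-(-A), 1⟩}) := by ring
      _ = Ideal.span {y₀ * x} * Ideal.span {(c₀ : ℤ√m)} := by rw [C]
      _ = Ideal.span {y₀ * x * (c₀ : ℤ√m)} := by rw [Ideal.span_singleton_mul_span_singleton]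
  have hne : x₀ * y * (c₀ : ℤ√m) ≠ 0 := mul_ne_zero (mul_ne_zero hx₀ hy) (by exact_mod_cast hc₀)
  have hrd' : r * d ∣ A ^ 2 - m := by rw [sq]; exact hrd
  exact principal_norm_of_rel hm (mul_pos hr hd) hrd' hne E2

/-- **THEOREM E «⇐», Finset family form.**  `m < 0`; weights `c i` (`i ∈ s`) with `c i · d i = L`, an auxiliary norm `r > 0`
with `r L ∣ A² − m`, bookkeeping hypotheses `gcd(d i, c i, 2A) = gcd(r, d i, 2A) = 1`, a base index `i₀ ∈ s` with proper
`𝔞_{c i₀}(A)`, alignments `(x i)·𝔞_{c i}(A) = (y i)·𝔞_{c i₀}(A)` and the auxiliary class relation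
`(x₀)·𝔞_r(A)·𝔞_L(A) = (y₀)·𝔞_{c i₀}(A)`.  Then EVERY weight has a primitive `z i` with `N (z i) = r · d i = T ∕ c i` dividing
the SAME `A − √m`: the line is reached at `(T, A) = (r L, A)` in the sense of THEOREM CF⁶'s criterion. -/
theorem classLaw_sufficiency {m : ℤ} (hm : m < 0) {ι : Type*} (s : Finset ι) {A r L : ℤ} (c d : ι → ℤ)
    (hr : 0 < r) (hd : ∀ i ∈ s, 0 < d i) (hcd : ∀ i ∈ s, c i * d i = L) (hdiv : r * L ∣ A * A - m)
    (hg1 : ∀ i ∈ s, Int.gcd (Int.gcd (d i) (c i) : ℤ) (2 * A) = 1)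
    (hg2 : ∀ i ∈ s, Int.gcd (Int.gcd r (d i) : ℤ) (2 * A) = 1)
    {i₀ : ι} (hi₀ : i₀ ∈ s) {k₀ : ℤ} (hk₀ : A ^ 2 - c i₀ * k₀ = m)
    (hp₀ : ∃ x y z : ℤ, x * c i₀ + y * (2 * A) + z * k₀ = 1)
    (x y : ι → ℤ√m) (hy : ∀ i ∈ s, y i ≠ 0)
    (halign : ∀ i ∈ s, Ideal.span {x i} * Ideal.span {(c i : ℤ√m), ⟨-A, 1⟩} =
      Ideal.span {y i} * Ideal.span {(c i₀ : ℤ√m), ⟨-A, 1⟩})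
    {x₀ y₀ : ℤ√m} (hx₀ : x₀ ≠ 0)
    (haux : Ideal.span {x₀} * (Ideal.span {(r : ℤ√m), ⟨-A, 1⟩} * Ideal.span {(L : ℤ√m), ⟨-A, 1⟩}) =
      Ideal.span {y₀} * Ideal.span {(c i₀ : ℤ√m), ⟨-A, 1⟩}) :
    ∀ i ∈ s, ∃ z : ℤ√m, z.norm = r * d i ∧ z ∣ (⟨A, -1⟩ : ℤ√m) ∧ IsCoprime z.re z.im := by
  intro i hi
  have hc₀ : c i₀ ≠ 0 := by
    intro h0
    have := hcd i₀ hi₀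
    rw [h0, zero_mul] at this
    -- L = 0 contradicts c i * d i = L with d i > 0 … unless c i = 0; use r L ∣ A² − m with m < 0: A² − m > 0 but 0 ∣ … forces A² − m = 0
    rw [← this, mul_zero] at hdiv
    have h0' : A * A - m = 0 := zero_dvd_iff.1 hdiv
    nlinarith [mul_self_nonneg A]
  exact weightDatum_of_aligned hm hr (hd i hi) hc₀ (hcd i hi) hdiv (hg1 i hi) (hg2 i hi) hk₀ hp₀ hx₀ (hy i hi)
    (halign i hi) haux

/-- **The cofactor's class (§6⁗ «⇒», REF-W ROW 355's sign).**  A datum `z · w = A − √m` of the weight `c` at the winding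
`T = c · N z = s · L` (`T ≠ 0`, `T ∣ A² − m`, bookkeeping `gcd(s, L, 2A) = 1`) satisfies
`(z)·𝔞_c(A) = 𝔞_s(A)·𝔞_L(A)`: the class of the cofactor ideal `𝔞_s(A)` is `κ − [𝔞_L(A)]`, `κ = [𝔞_c(A)]` the common class
of the line.  (#B17: `(z)·𝔞_c(A) = 𝔞_T(A)`; #B14: `𝔞_T(A) = 𝔞_s(A)·𝔞_L(A)`.)  So the reachable windings of a line are
`T = L · s` with `𝔞_s` running over the compatible primitive ideals of that class — the least such norm gives the first `T`. -/
theorem firstWinding_relation {m A T s L c : ℤ} {z w : ℤ√m} (h : z * w = ⟨A, -1⟩) (hT : T = c * z.norm)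
    (hsL : s * L = T) (hdiv : T ∣ A * A - m) (hT0 : T ≠ 0) (hg : Int.gcd (Int.gcd s L : ℤ) (2 * A) = 1) :
    Ideal.span {z} * Ideal.span {(c : ℤ√m), ⟨-A, 1⟩} =
      Ideal.span {(s : ℤ√m), ⟨-A, 1⟩} * Ideal.span {(L : ℤ√m), ⟨-A, 1⟩} := by
  rw [principal_mul_weightIdeal h hT hdiv hT0, primIdeal_mul_of_gcd (by rw [hsL]; exact hdiv) hg, hsL]

end Summit.Ventures.HSemireg.LineLawClassLawSufficiency
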